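import Summits.Schanuel.Schanuel.Theorems.RootDecomp1KSectorSubspace04

/-!
# RootDecomp1KSectorSubspace — lens 1, generation 70, NODE 30 «THE (4,2)-SECTOR BOX WITH SIMPLE EDGE ROOTS IS SUBSPACE» (×0-AS-RECORD, CONDITIONAL LANE — PRICE L3112, RULING L3115 (4); CLAIM L3110, NODE L3125, VERDICT L3131): for the (4,2)-sector box `boxP q` = (Y⁴ + δY³ + ζ₂Y² + ζ₁Y + ζ₀) + x·(αY² + βY + ε) + γ·x² with γ ODD and the edge quartic W⁴ + αW² + γ SEPARABLE, WINDOW LEVEL-FINITENESS and hence `LevelFinite` / `ThinFibreAt m₀` for every m₀ MODULO the route's existing binder `PadicSubspace` (hypothesis `hS`, never an axiom): `window_levels_finite`, `levelFinite_box_of_padicSubspace`, `thinFibreAt_box_of_padicSubspace`; node 11's second-order Subspace lever (tree `Lform` / `Mform` / `nearest_root` / `isAlgebraic_corr` BY NAME) transplanted to the (∞,∞) sector and closed by `transcendental_liouvilleNumber`; (H7) the GENERIC member (separable Δ_x) is node 23's — `thinFibreAt_box_of_separable_pDisc` hypothesis-free, `domHyper_box_iff`, `thinFibreAt_box_dichotomy`;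 consistency probe ρ1 (`thinFibreAt_rho1_of_padicSubspace`, unconditional by node 28); specimen M30 = (Y⁴ − Y³ − 6Y² + 2Y + 15) + x·(4Y² + Y − 27) + 11x² (singular at (1,1), ¬DomHyper, not split in the given coordinates, split after translation): `thinFibreAt_m30_of_padicSubspace` — continuation (RootDecomp1KSectorSubspace05): (continuation of the previous §) — 1 declarations `thinFibreAt_box_dichotomy` … `thinFibreAt_box_dichotomy`

(lens-1 g70 NODE 30 «THE (4,2)-SECTOR BOX WITH SIMPLE EDGE ROOTS IS SUBSPACE» L3125: HOME kernel K = HOME/decomp-schanuel-lens-1/g70/lean/SectorSubspace.lean sha256 30de2f8e…, 1334 l, 87 decls (78 theorems + 8 defs + 1 structure `SectorBox`), ONE namespace `Summit.Schanuel.Schanuel.Theorems.RootDecomp1KSectorSubspace`, imports the tree port …RootDecomp1KExhibitDescent03 ONLY (node 29's record port; `PadicSubspace` / `Lform` / `Mform` / `nearest_root` / `isAlgebraic_corr` (SubspaceBranch), `rho1` (SectorTheorem), `pDisc` / `DomHyper` / `thinFibreAt_dom2` (HyperellipticSiegel), `thinFibreAt_of_levelFinite`, `tendsto_partialSum_two`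 BY TREE NAME); no private / instance / set_option / notation / sorry / new axiom; the binder `PadicSubspace` appears ONLY as the hypothesis `hS` of the `…_of_padicSubspace` heads; lens farm rc 0 · 0 errors · 0 sorries · 99 dupNamespace, `--axioms` standard on 13 heads, Probe g70/out/Probe.lean e9bf9f63… rc 0 (rfl pins @PadicSubspace = tree, @rho1 = tree, @pDisc / @DomHyper / @LevelFinite = tree), CONTROL ProbeCtrl ec7805c4… rc 1 as designed, memo g70/NODE-g70.md 51b8502c…, SHA256SUMS 23/23; CLAIM L3110 (ASK-FIRST; conditional class theorem, no new binder, no exhibit); crit g12 PRICE 30 L3112: ×0-AS-RECORD, PORT WELCOME (conditional lane, like W4Dossier01 — K-R56 (ii)/(iii), the W4 precedent RULING L2988, K-R58 (iii): the binder PROVED is the one payable head), CHECKLIST K-g70 (H1)–(H6) + (S), W-30-1; writer g36 NOTE 4 L3113 (arithmetic pre-check 11/11 on 122 472 cleared quartics); census INSTRUMENT NOTE 48 L3114 (CE-25-1: the residue exhibits of record were DomHyper) and crit RULING L3115 ((3) ERRATUM E7 FIXED; (4) PRICE 30 REFINED: the box ∩ {{Δ_x separable}} is ALREADY DECIDED UNCONDITIONALLY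 by node 23's `thinFibreAt_dom2`, node 30's proper conditional reach = the SINGULAR members (α)/(β), CHECKLIST += (H7)); writer NOTE 5 L3123 (exhaustive box census 15 309: separable 14 498 / inseparable 811); census LIVENESS-v43 key box30 (rows 63 rho1 / 70 ρ1′ / 73 specimen); crit g13 VERDICT 30 L3131: «×0-AS-RECORD — BOOKED as priced (PRICE L3112, RULING L3115 (4)); CHECKLIST K-g70 (H1)–(H7) + (S) MET; NO objection to any kernel statement; three errata-lite in PROSE only (e30-2 lens, e30-3 writer, CE-25-2 census), all on the abscissa convention — zero kernel and zero record consequence; decl census 90 = 81 theorems + 8 defs + 1 structure (the three @[simp] lemmas svec_zero/one/two counted); --axioms on 33 heads standard, PadicSubspace ONLY as the explicit binder hS; RECORD AT VERDICT 30: Dom(PadicSubspace) map entry := {node 11 SepTopAt classes, W4, node-30 box ∖ DomHyper}, the DomHyper part printed in the UNCONDITIONAL lane as node 23 (H7); open territory / exhibits VACANT / ledger / tally UNCHANGED; PORT GO (conditional lane, W4Dossier01 precedent; every …_of_padicSubspace head keeps (hS : PadicSubspace) explicit; statements byte-verbatim to K; e30-2 docstring clause at the census choice — carried VERBATIM here,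 e30-2 standing in the errata list)». PORT-SIDE MODIFIER (bounce p850098, dedup.landed): K l.607 abs_num_eq ≡ tree RootDecomp1EPointTransfer.abs_num_eq ⇒ PRIVATE in part 02 + a private copy in part 03 (one use each), statements / proofs = K. Port by census-1 gen 25 as `RootDecomp1KSectorSubspace01–05` (files ≤ 400 lines; `--supports stmt-Schanuel-33364`, the item stays OPEN; ×0 record port in the CONDITIONAL lane — every `…_of_padicSubspace` head carries the hypothesis `hS : PadicSubspace` explicitly (W4Dossier01 precedent); no credit anywhere; record effect at VERDICT 30 = the MAP entry Dom(PadicSubspace) ∪= node-30 box ∖ DomHyper, the DomHyper part in the unconditional lane (node 23)): 01 = K l.1–384 of the prepped source (opens # §0 / # §1) — 25 decls `norm_two_ss`, `norm_two_pow_ss`, `norm_intCast_le_one_ss`, …, `eventually_K₀_small_ss`; 02 = K l.385–691 of the prepped source (opens # §2 / # §3 / # §4 / # §5) — 16 decls `level_shape`, `level_padic`, `first_order`, …, `sector_arith`; 03 = K l.692–1012 of the prepped source (opens # §6) — 11 decls `bev_boxP_liouville_ne_zero`, `no_point_near`, `level_le_two_mul_pow`, …, `thinFibreAt_box_of_padicSubspace'`;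 04 = K l.1013–1333 of the prepped source (opens # §7 / # §8 / # §9) — 37 decls `level_second_order`, `rho1Box`, `boxC_rho1Box`, …, `domHyper_box_iff`; 05 = K l.1334–1343 of the prepped source (inside # §9) — 1 decls `thinFibreAt_box_dichotomy`. 0 one-line docstrings synthesised for undocumented helper declarations (statements quoted); everything else = K VERBATIM (statements, names, proofs, K's module docstring kept in part 01 below this provenance block).)
-/

noncomputable section

namespace Summit.Schanuel.Schanuel.Theorems.RootDecomp1KSectorSubspace

open Polynomial LiouvilleNumber
open scoped Nat
open Summit.Schanuel.Schanuel.Theorems.RootDecomp1KTwoBaseCell (psNumer partialSum_eq_psNumer_div coprime_psNumer)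
open Summit.Schanuel.Schanuel.Theorems.RootDecomp1KRelLiouvilleCell (partialSum_two_strictMono)
open Summit.Schanuel.Schanuel.Theorems.RootDecomp1KDegreeLadder
open Summit.Schanuel.Schanuel.Theorems.RootDecomp1KXLinearCore
open Summit.Schanuel.Schanuel.Theorems.RootDecomp1KXLinear
open Summit.Schanuel.Schanuel.Theorems.RootDecomp1KXLinearII
open Summit.Schanuel.Schanuel.Theorems.RootDecomp1KXTop
open Summit.Schanuel.Schanuel.Theorems.RootDecomp1KSubspaceBranch
open Summit.Schanuel.Schanuel.Theorems.RootDecomp1KDigitPincer (odd_psNumer_two)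
open Summit.Schanuel.Schanuel.Theorems.RootDecomp1KSectorTheorem (rho1 tendsto_partialSum_two)
open Summit.Schanuel.Schanuel.Theorems.RootDecomp1KHyperellipticSiegel (pDisc DomHyper domHyper_xPolyP_iff thinFibreAt_dom2 levelFinite_dom2)
open Summit.Schanuel.Schanuel.Theorems.RootDecomp1KIntegrality (DomZero)
open Summit.Schanuel.Schanuel.Theorems.RootDecomp1KLevelFinite (LevelSet LevelFinite thinFibreAt_of_levelFinite)
open Summit.Schanuel.Schanuel.Theorems.RootDecomp1KHeightGrading (BddLevelEmpty bddLevelEmpty_iff_levelFinite)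

/-- **THE DICHOTOMY OF THE BOX** (`γ` odd, edge separable): EITHER `Δ_x` is separable and the member is decided
HYPOTHESIS-FREE by node 23, OR `Δ_x` is inseparable (a SINGULAR member) and it is decided MODULO `PadicSubspace` by
this node — in both cases `ThinFibreAt m₀` for every `m₀`. -/
theorem thinFibreAt_box_dichotomy (q : SectorBox) (hγ : Odd q.γ)
    (hedge : ((edgeF q).map (Int.castRingHom ℚ)).Separable) (m₀ : ℕ) :
    (((pDisc (boxC q)).map (Int.castRingHom ℚ)).Separable → ThinFibreAt m₀ (boxP q)) ∧
      (PadicSubspace → ThinFibreAt m₀ (boxP q)) :=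
  ⟨fun hsep => thinFibreAt_box_of_separable_pDisc' q hedge hsep m₀,
    fun hS => thinFibreAt_box_of_padicSubspace hS q hγ hedge m₀⟩

end Summit.Schanuel.Schanuel.Theorems.RootDecomp1KSectorSubspace
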